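import Summits.CriticalPhenomena.PercolationContinuityZ3.Theorems.PercNearOneGluingNoHeavyLowerTailFrontierDecRowsEdgeInduction
import Summits.CriticalPhenomena.PercolationContinuityZ3.Theorems.PercNearOneGluingNoHeavyLowerTailFourPointAtoms
import Literature.Probability.LatticeModels.ProdBernoulliIndependence
import HarnessLib

/-!
# The increasing star: the ROOT–TARGET Bernstein step, I — one-edge lifting of hub connections

Support file for the Sahi programme (`--supports stmt-CriticalPhenomena-4575`, prover prim-sahi-p2 gen 4).  No definitions, no named facts, no
sorries, no `native_decide`; standard axioms.  Memo `run/shared/lean/prim/prim-sahi/FROM-prim-sahi-p2-gen4-INC-STAR.md` §7–8.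

For the increasing star `T(w) = E₃({a↔b},{a↔c},{a↔y})` under `prodBernoulli w` and the ROOT–TARGET pair `e = s(a,b)`, the cubic `p_e ↦ T` has
mixed Bernstein coefficients `B₁ = polar₁(P_{w[e↦0]}, P_{w[e↦1]})`, `B₂ = polar₁(P_{w[e↦1]}, P_{w[e↦0]})` (tree: `EdgeInduction.sahiE3_oneBond`).
Under `P_{w[e↦1]}` the pair `e` is almost surely open, so every hub event lifts to `P_{w[e↦0]}` of a union: `P_{w[e↦1]}({a↔x}) =
P_{w[e↦0]}({a↔x} ∪ {b↔x})` (`real_update_one_eq_preimage_insert`, `preimage_insert_openConn`).  Both coefficients thereby become cubic forms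
in the fifteen cells of the four-point law of `(a,b,c,y)` under `w[e↦0]`, and each is an exact nonnegative combination of (Harris inequality for
two increasing four-point events) × (a cell), of the increasing star of `w[e↦0]` itself (the induction hypothesis of the edge induction), and of
cubic cell monomials — certificates found by LP (kit jobs of this seat) and replayed here by `linarith` (`rootTarget_polar_nonneg`).  With
`IncStar.incStar_nonneg_of_rootEdgeBernstein` (…IncStarRootEdgeInduction) this discharges the root–target half of the root-edge induction; the
root–unmarked half (five-point forms) remains.
-/

noncomputable section

namespace Summit.CriticalPhenomena.PercolationContinuityZ3.Theorems

namespace IncStar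

open MeasureTheory Set Literature.Probability.Percolation Literature.Probability.LatticeModels EdgeInduction FourPointAtoms
open Summit.CriticalPhenomena.PercolationContinuityZ3.Cruxes.AdditiveGluing.TieLine.ConnAtoms
open scoped Classical

variable {V : Type*}

/-- Reachability after opening one more pair `s(u₀,v₀)`: a vertex reached from `u` is reached in the old configuration from `u`, or
`u` reaches `{u₀,v₀}` and `{u₀,v₀}` reaches it in the old configuration. [folklore] -/
theorem reachable_insert_imp (ω : BondConfig V) (u₀ v₀ : V) {u x : V}
    (h : (openGraph (insert s(u₀, v₀) ω)).Reachable u x) :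
    (openGraph ω).Reachable u x ∨
      (((openGraph ω).Reachable u u₀ ∨ (openGraph ω).Reachable u v₀) ∧
        ((openGraph ω).Reachable u₀ x ∨ (openGraph ω).Reachable v₀ x)) := by
  obtain ⟨p⟩ := h
  induction p with
  | nil => exact Or.inl SimpleGraph.Reachable.rfl
  | @cons u v x' hadj p ih =>
    rw [openGraph_adj, Set.mem_insert_iff] at hadj
    obtain ⟨hmem, hne⟩ := hadj
    rcases hmem with heq | hω
    · -- the new pair: {u,v} = {u₀,v₀}
      have huv : (u = u₀ ∧ v = v₀) ∨ (u = v₀ ∧ v = u₀) := Sym2.eq_iff.1 heq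
      have hu : (openGraph ω).Reachable u u₀ ∨ (openGraph ω).Reachable u v₀ := by
        rcases huv with ⟨rfl, -⟩ | ⟨rfl, -⟩
        · exact Or.inl SimpleGraph.Reachable.rfl
        · exact Or.inr SimpleGraph.Reachable.rfl
      have hv : ∀ {z}, (openGraph ω).Reachable v z → (openGraph ω).Reachable u₀ z ∨ (openGraph ω).Reachable v₀ z := by
        intro z hz
        rcases huv with ⟨-, rfl⟩ | ⟨-, rfl⟩
        · exact Or.inr hz
        · exact Or.inl hz
      rcases ih with h1 | ⟨_, h3⟩
      · exact Or.inr ⟨hu, hv h1⟩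
      · exact Or.inr ⟨hu, h3⟩
    · have huv : (openGraph ω).Reachable u v := SimpleGraph.Adj.reachable (by rw [openGraph_adj]; exact ⟨hω, hne⟩)
      rcases ih with h1 | ⟨h2, h3⟩
      · exact Or.inl (huv.trans h1)
      · refine Or.inr ⟨?_, h3⟩
        rcases h2 with h2 | h2
        · exact Or.inl (huv.trans h2)
        · exact Or.inr (huv.trans h2)

/-- **Lifting a hub connection through the root edge**: with `e = s(s,b)`, `s ≠ b`, the configuration `ω ∪ {e}` joins `s` to `x` iff `ω` joins `s`
or `b` to `x`. [folklore] -/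
theorem insert_mem_openConn_iff (ω : BondConfig V) {s b : V} (hsb : s ≠ b) (x : V) :
    insert s(s, b) ω ∈ openConn s x ↔ ω ∈ openConn s x ∨ ω ∈ openConn b x := by
  simp only [openConn, Set.mem_setOf_eq]
  constructor
  · intro h
    rcases reachable_insert_imp ω s b h with h | ⟨_, h⟩
    · exact Or.inl h
    · exact h
  · have hle : openGraph ω ≤ openGraph (insert s(s, b) ω) := by
      intro u v huv; rw [openGraph_adj] at huv ⊢; exact ⟨Set.mem_insert_of_mem _ huv.1, huv.2⟩
    rintro (h | h)
    · exact h.mono hle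
    · have hsb' : (openGraph (insert s(s, b) ω)).Reachable s b :=
        SimpleGraph.Adj.reachable (by rw [openGraph_adj]; exact ⟨Set.mem_insert _ _, hsb⟩)
      exact hsb'.trans (h.mono hle)

/-- Preimage form of `insert_mem_openConn_iff`. [folklore] -/
theorem preimage_insert_openConn {s b : V} (hsb : s ≠ b) (x : V) :
    (fun ω : BondConfig V => insert s(s, b) ω) ⁻¹' openConn s x = openConn s x ∪ openConn b x := by
  ext ω; simp only [Set.mem_preimage, Set.mem_union]; exact insert_mem_openConn_iff ω hsb x

end IncStar

end Summit.CriticalPhenomena.PercolationContinuityZ3.Theorems
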